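import Summits.KontsevichZagierPeriods.KontsevichZagierPeriods.Theses.FurushoPentagon
import Summits.KontsevichZagierPeriods.KontsevichZagierPeriods.Theses.LiftingCriteria
import Summits.KontsevichZagierPeriods.KontsevichZagierPeriods.Theorems.FurushoPentagonReducedPeriodRingDefs
import Literature.NumberTheory.Transcendental.KZCubicalCalculus
import Literature.NumberTheory.Transcendental.KZCalculusProofs
import Literature.NumberTheory.Transcendental.KZLogCalculusProofs
import Literature.NumberTheory.Transcendental.KZVolumeConjectureProofs
import Literature.NumberTheory.Transcendental.KZRulesAssociator

/-!
# `SectorToKernel`, line `effective-cube-surjection`: the resolution stub S1 reduced to existing statements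

Crux `FurushoPentagon.SectorToKernel` (stmt-KontsevichZagierPeriods-10813), line
`effective-cube-surjection`, stub S1 `stub_cubeResolution` ("every integral representation is, modulo
the KZ relations, a `ℤ`-combination of tame cube classes"; byte-identical with stub S1b of the sibling
crux `ReducedPeriodRing`, stmt-3929). S1 is the one theorem-grade stub of the line that is not landed:
its content is a cubical resolution of the boundary singularities of Nash integrands (Hironaka /
Bierstone–Milman strength). This file isolates it against statements that already exist in the tree:

* `cubeResolution_of_cubeNashNormalForm` — S1 follows VERBATIM from the existing item
  stmt-KontsevichZagierPeriods-3574 `LiftingCriteria.CubeNashNormalForm` (route LiftingCriteria): pass to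
  a rational-shape representation (`KZ.exists_isRational_equivalent_holds`, Kontsevich–Zagier 2001 §1.1),
  apply the normal form against the unit representation `[pt, 1]` (itself a tame cube class of
  dimension `0`), and replace each cube representation of the normal form by the tame cube class of
  its Nash integrand (integrand additivity with a zero representation,
  `KZ.of_sub_of_mem_relations_of_eqOn`).
* `cubeResolution_of_boundedVolumes` — the sharper residue: by the tree's PROVED semi-canonical
  reduction (Viu-Sos 2021, `KZ.exists_sub_isBounded`: every representation is `≡ [A] − [B]` with
  `A`, `B` BOUNDED volumes one dimension up) it suffices to resolve bounded volume classes
  `[K, 1]`, `K ⊆ ℝᵐ` bounded `ℚ`-semialgebraic.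

## References

* M. Kontsevich, D. Zagier, *Periods* (2001), §1.1–1.2. [KontsevichZagier2001]
* J. Ayoub, *Periods and the conjectures of Grothendieck and Kontsevich–Zagier*, EMS Newsl. 91 (2014),
  Rem. 12. [Ayoub2014]
* J. Viu-Sos, *A semi-canonical reduction for periods of Kontsevich–Zagier*, Int. J. Number Theory 17
  (2021), Thm. 1.1, Cor. 2.3. [ViuSos2021]
* A. Huber, S. Müller-Stach, *Periods and Nori Motives* (2017), §12.2. [HuberMullerStach2017]
-/

noncomputable section

namespace Summit.KontsevichZagierPeriods.FurushoPentagon.SectorToKernel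

open Set MeasureTheory
open Literature.NumberTheory.Transcendental
open Literature.NumberTheory.Transcendental.KZ hiding cubicalSpan
open Summit.KontsevichZagierPeriods.KontsevichZagierPeriods.Theses.FurushoPentagon
open Summit.KontsevichZagierPeriods.FurushoPentagon.ReducedPeriodRing (unitCube cubicalGens cubicalSpan)

/-- The closed unit cube written as a product of intervals is the tree's `KZ.cube`. [folklore] -/
theorem cubeRes_pi_Icc_eq_cube (n : ℕ) :
    Set.pi Set.univ (fun _ : Fin n => Set.Icc (0 : ℝ) 1) = KZ.cube n := by
  ext x
  simp only [Set.mem_univ_pi, Set.mem_Icc, KZ.mem_cube]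

/-- The unit representation `[pt, 1]` is a tame cube class (dimension `0`). [folklore] -/
theorem cubeRes_of_unit_mem_cubicalGens : of IntegralRep.unit ∈ cubicalGens := by
  refine ⟨0, IntegralRep.unit, ?_, ?_, rfl⟩
  · rw [IntegralRep.unit_domain]
    ext x
    simp [ReducedPeriodRing.mem_unitCube]
  · rw [IntegralRep.unit_integrand]
    exact analyticOnNhd_const

/-- A tame cube representation (`KZ.tameCube`) is a tame cube class. [folklore] -/
theorem cubeRes_of_tameCube_mem_cubicalGens {n : ℕ} (f : (Fin n → ℝ) → ℝ)
    (hf : AnalyticOnNhd ℝ f (KZ.cube n)) (hsa : IsSemialgebraicFunOn ℚ (KZ.cube n) f) :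
    of (IntegralRep.tameCube f hf hsa) ∈ cubicalGens :=
  ⟨n, IntegralRep.tameCube f hf hsa, rfl, hf, rfl⟩

/-- `ℤ`-multiples of sums of tame cube classes lie in `cubicalSpan`. [folklore] -/
theorem cubeRes_sum_zsmul_mem_cubicalSpan {S : ℕ} (ε : Fin S → ℤ) (t : Fin S → FormalRep)
    (ht : ∀ i, t i ∈ cubicalGens) : ∑ i, ε i • t i ∈ cubicalSpan :=
  AddSubgroup.sum_mem _ fun i _ => AddSubgroup.zsmul_mem _ (AddSubgroup.subset_closure (ht i)) _

/-- **S1 from the cube-Nash normal form (item stmt-KontsevichZagierPeriods-3574).** If every difference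
of rational-shape representations is KZ-equivalent to a `ℤ`-combination of cube representations with
Nash integrands analytic on a neighbourhood of the closed cube (`LiftingCriteria.CubeNashNormalForm`),
then every integral representation is, modulo the KZ relations, a `ℤ`-combination of tame cube
classes — the registered stub `stub_cubeResolution` of line `effective-cube-surjection`, verbatim.
[Kontsevich–Zagier 2001, §1.1; Ayoub 2014, Rem. 12] -/
theorem cubeResolution_of_cubeNashNormalForm :
    Summit.KontsevichZagierPeriods.KontsevichZagierPeriods.Theses.LiftingCriteria.CubeNashNormalForm → ∀ (N : ℕ) (u : IntegralRep N), ∃ c : FormalRep, c ∈ cubicalSpan ∧ of u - c ∈ relations := by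
  intro hN N u
  -- (1) pass to a representation of KZ's literal rational shape
  obtain ⟨m, R, hR, huR⟩ := exists_isRational_equivalent_holds u
  -- (2) the cube-Nash normal form of `[R] − [pt, 1]`
  --     (`[pt, 1]` has KZ's rational shape with `p = q = 1`; this is the sibling theorem
  --     `HurwitzMicroSectors.NormalFormPrinciple.Negative.isRational_unit`, inlined to keep imports small)
  obtain ⟨S, n, g, U, ε, s, hg, hs, hrel⟩ :=
    hN m 0 R IntegralRep.unit hR ⟨1, 1, fun _ _ => by simp, fun _ _ => by simp⟩
  -- (3) the tame cube classes of the Nash integrands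
  have hga : ∀ i, AnalyticOnNhd ℝ (g i) (KZ.cube (n i)) := fun i =>
    (hg i).2.2.2.mono (by rw [← cubeRes_pi_Icc_eq_cube]; exact (hg i).2.1)
  have hgs : ∀ i, IsSemialgebraicFunOn ℚ (KZ.cube (n i)) (g i) := fun i =>
    (hg i).2.2.1.mono (by rw [← cubeRes_pi_Icc_eq_cube]; exact (hg i).2.1) KZ.isSemialgebraic_cube
  set t : (i : Fin S) → IntegralRep (n i) := fun i => IntegralRep.tameCube (g i) (hga i) (hgs i)
    with ht_def
  have hst : ∀ i, of (s i) - of (t i) ∈ relations := by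
    intro i
    refine of_sub_of_mem_relations_of_eqOn ?_ ?_
    · rw [ht_def, IntegralRep.tameCube_domain, (hs i).1, cubeRes_pi_Icc_eq_cube]
    · intro z hz
      rw [(hs i).1] at hz
      rw [ht_def, IntegralRep.tameCube_integrand]
      exact (hs i).2 z hz
  -- (4) the combination
  refine ⟨of IntegralRep.unit + ∑ i, ε i • of (t i), ?_, ?_⟩
  · exact cubicalSpan.add_mem (AddSubgroup.subset_closure cubeRes_of_unit_mem_cubicalGens)
      (cubeRes_sum_zsmul_mem_cubicalSpan ε _ fun i => cubeRes_of_tameCube_mem_cubicalGens _ _ _)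
  · have hsum : ∑ i, ε i • of (s i) - ∑ i, ε i • of (t i) ∈ relations := by
      rw [← Finset.sum_sub_distrib]
      refine AddSubgroup.sum_mem _ fun i _ => ?_
      rw [← zsmul_sub]
      exact AddSubgroup.zsmul_mem _ (hst i) _
    have : of u - (of IntegralRep.unit + ∑ i, ε i • of (t i)) =
        (of u - of R) + (of R - of IntegralRep.unit - ∑ i, ε i • of (s i)) +
          (∑ i, ε i • of (s i) - ∑ i, ε i • of (t i)) := by abel
    rw [this]
    exact relations.add_mem (relations.add_mem huR hrel) hsum

/-- **S1 from the resolution of bounded volumes.** By the tree's semi-canonical reduction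
(`KZ.exists_sub_isBounded`, Viu-Sos 2021 Cor. 2.3: every representation is `≡ [A] − [B]` modulo the
KZ relations with `A`, `B` bounded `ℚ`-semialgebraic volumes one dimension up), the registered stub
`stub_cubeResolution` reduces to its instance for bounded volume classes `[K, 1]`.
[Viu-Sos 2021, Thm. 1.1, Cor. 2.3; Ayoub 2014, Rem. 12] -/
theorem cubeResolution_of_boundedVolumes :
    (∀ (m : ℕ) (K : IntegralRep m), Bornology.IsBounded K.domain → (∀ x ∈ K.domain, K.integrand x = 1) → ∃ c : FormalRep, c ∈ cubicalSpan ∧ of K - c ∈ relations) → ∀ (N : ℕ) (u : IntegralRep N), ∃ c : FormalRep, c ∈ cubicalSpan ∧ of u - c ∈ relations := by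
  intro h N u
  obtain ⟨A, B, hA, hB, hA1, hB1, huAB⟩ := exists_sub_isBounded u
  obtain ⟨a, ha, hAa⟩ := h (N + 1) A hA hA1
  obtain ⟨b, hb, hBb⟩ := h (N + 1) B hB hB1
  refine ⟨a - b, cubicalSpan.sub_mem ha hb, ?_⟩
  have : of u - (a - b) = (of u - (of A - of B)) + (of A - a) - (of B - b) := by abel
  rw [this]
  exact relations.sub_mem (relations.add_mem huAB hAa) hBb

end Summit.KontsevichZagierPeriods.FurushoPentagon.SectorToKernel
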